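import Literature.AnabelianGeometry.EtaleTheta.ThetaKummerInversionTransport
import Literature.AnabelianGeometry.EtaleTheta.SettingModelChiInversionTheta
import Literature.AnabelianGeometry.EtaleTheta.SettingModelChiThetaDoubleUnderline
import HarnessLib

/-!
# The FUNCTION-level [EtTh] Prop 1.4 (ii) package for an inversion: what the `ι`-FIXED elements of `Π^tp_Ÿ` must
# do (a rigidity constraint on inversion data), and its reading at the χ-twisted root model (proof-only)

S. Mochizuki, *The étale theta function …*, Publ. RIMS **45** (2009) [EtTh]: Prop 1.4 (ii) p. 22 («`Θ̈(Ü) = −Θ̈(Ü⁻¹)`»),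
Prop 1.3 p. 21 (Kummer classes of constants, «the composite of the Kummer map `O^×_K̈ → H¹(G_K̈, Δ_Θ)` with …»),
Def 2.1 p. 36 / Prop 2.2 (i) p. 37 (the inversion `ι`, `+1` on `Δ_Θ`), Thm 1.6 p. 24. Classical here.

abc-iut cell, layer L2, seat abc-iut-w5-d125 (gen 7); PROOF-ONLY (NO definition, NO `Prop` fact, NO instance; D-0067).
Sequel of `ThetaKummerInversionTransport.lean` (p443746/p443959: GAP G-L2t2-1's binder `hιη` from the FUNCTION-level
package). THIS FILE records a CONSTRAINT that the function-level package imposes on the inversion datum — needed to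
SIZE any non-vacuity witness of the END-TO-END theorems of that file and of abc-iut-w4-d004's L6 twins:

* `ThetaKummerInput.smul_inversionRoot_eq` — if `ιFn` is an `ι`-twisted-equivariant pull-back of functions
  (`hιFn`) acting trivially on `Λ(Fn)` (`hΛ`, the collapsed coefficient compatibility under Prop 2.2 (i)), then every
  `ι`-FIXED element `g` of `Π^tp_Ÿ` FIXES `d_N := ιFn(θ_N)·θ_N⁻¹` for every compatible root `θ_N` of `Θ̈` (the Kummer
  cocycle value `g•θ_N/θ_N ∈ Λ(Fn)` is `ιFn`-fixed, and `ιFn (g • θ_N) = g • ιFn θ_N`).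
* `ThetaKummerInput.kummerCocycle_mul_inversionRoot_eq` — the general identity behind it (no fixedness): for
  `g, ι g ∈ Π^tp_Ÿ`, `λ_Θ̈(g) · d = (ι g • d) · λ_Θ̈(ι g)` — the defect of `ι`-invariance of the theta Kummer cocycle is
  the Kummer cocycle of `d` (a root system of `const(−1)`); so a model whose theta class is NEGATED by the inversion on
  elements fixing `d` (a «`y`-coordinate class») can never carry the package — print's `η̈^Θ` is the `ι`-invariant
  centre class.
* `ThetaKummerInput.map_kummerCocycle_mul_inversionRoot_eq` — the same without `hΛ` (general companion `β`):
  `ιFn(λ_Θ̈(g)) · d = (ι g • d) · λ_Θ̈(ι g)`.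
* `ThetaKummerInput.res_kummerConst_neg_one_eq_one_of_fixed` — with `hιθ : ιFn Θ̈ = const(−1)·Θ̈` the family
  `(d_N)_N` is a compatible ROOT SYSTEM OF `const(−1)`, so (independence of the Kummer class from the root system,
  abc-iut-L2-t12) **the Kummer class `κ(−1) ∈ H¹(Π^tp_Ÿ, Δ_Θ)` RESTRICTS TO `1` on every subgroup `H₀ ≤ Π^tp_Ÿ` of
  `ι`-fixed elements**; `…_of_constCompat` — the same for the abstract class `infl(kumYdd(−1))` of any Kummer datum
  `k` with `T.ConstCompat k`. CONTRAPOSITIVE (`not_exists_package_of_res_kummerConst_ne_one`): an inversion datum whose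
  fixed subgroup inside `Π^tp_Ÿ` SEES `κ(−1)` admits NO function-level package — in print the inversion of `X` fixes no
  Galois section on which `−1` is Kummer-visible (it reverses the tangential base point at the origin).
* **`KummerCore.not_exists_package_of_constCompat_of_fixed` — NO-GO for genuine constants.** If `T` is compatible
  (`ConstCompat`) with the Kummer data of a Kummer CORE `C` (abc-iut-w5-d171: constants `ℚ̄_p^×`, `Ẑ(1) ≅ Δ_Θ`) and `ι`
  fixes pointwise a subgroup `H₀ ≤ Π^tp_Ÿ` whose Galois image `augTheta(H₀^Θ)` is `G_L` for a FINITE `L/ℚ_p`, then NO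
  `ιFn` satisfies the package: `κ(−1)|_{H₀} = 1` would make `−1 ∈ L^×` Kummer-trivial, contradicting
  Kummer-faithfulness `⋂_N (L^×)^N = 1` (abc-iut-L4 / w5-d171 `invariants_kummerFaithful`, `kummerContMap_injective`).
* AT THE χ-TWISTED ROOT MODEL `modelχ` (R78 cluster): abc-iut-L2-d1's inversion datum of record
  `twistedInversionTop (chi p) …` FIXES the complement `inr(G_{ℚ_p}) ≤ Π^tp_Ÿ` pointwise (`twistedInversion_inr`) and
  `aug ∘ inr = id`, so (`SettingModel.not_exists_package_modelχ_of_constCompat`) **for EVERY `T : ThetaKummerInput (modelχ p)`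
  with `ConstCompat (kummerDataχ p)` there is NO function-level package for this `ι`**; also the currency-free forms
  `res_inr_kummerConst_neg_one_eq_one_of_package` / `…inflTheta_kumYdd…`. MODEL-DESIGN CONSEQUENCE (numbers, not a
  side): the hypotheses of the END-TO-END theorems of `ThetaKummerInversionTransport.lean` (and of abc-iut-w4-d004's L6
  twins) are NOT jointly instantiable at (`modelχ`, inversion of record, genuine constants); a non-vacuity witness must
  use an inversion lift whose fixed part of `Π^tp_Ÿ` has NON-open Galois image — e.g. a `Π^tp_X`-conjugate `Ad(w) ∘ ι`
  with odd `y`-coordinate `ŷ(w)` (then `ι` fixes `inr σ` only up to the Kummer character of `−1`, as in print, where the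
  inversion reverses the tangential base point at the origin).

HONEST FRAMING: classical [EtTh] §1 mathematics over the cell's typed interface and its SEMI-SYNTHETIC χ-model
(consistency evidence only); nothing disputed is asserted; no side is taken on [IUTchIII] Cor 3.12; typed ≠ proved
elsewhere.
-/

noncomputable section

namespace Literature.AnabelianGeometry.EtaleTheta

open Literature.IUT.HodgeArakelov

/-! ### §0. A Kummer class with pointwise-trivial cocycle (bookkeeping) -/

namespace CyclotomeCoefficients

variable {G G' : Type*} [Group G] [TopologicalSpace G] [SeparatelyContinuousMul G]
  [Group G'] [TopologicalSpace G'] [IsTopologicalGroup G']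
  {φ : G →* G'} {A' : Subgroup G'} [A'.Normal] [IsMulCommutative A']
  {A : Type*} [CommGroup A] [MulDistribMulAction G A] [TopologicalSpace A]
  (c : CyclotomeCoefficients φ A' A) {a : A}

/-- A continuous Kummer class whose Kummer COCYCLE vanishes pointwise is trivial.
[cite: NeukirchSchmidtWingberg2008, I §5] -/
theorem kummerContClass_eq_one_of_forall_smul_eq (H : Subgroup G) (x : RootSystem a)
    (ha : a ∈ MulAction.fixedPoints H A) (hx : ∀ n : ℕ+, IsOpen (MulAction.stabilizer G (x.root n) : Set G))
    (hfix : ∀ (h : H) (n : ℕ+), (h : G) • x.root n = x.root n) :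
    c.kummerContClass H x ha hx = 1 := by
  rw [kummerContClass, ← ContH1.mk_one]
  refine ContH1.mk_congr H (funext fun h => ?_) _ _
  change c.hom (x.kummerCocycle ha h) = 1
  rw [← map_one c.hom]
  congr 1
  refine Subtype.ext (funext fun n => ?_)
  rw [RootSystem.kummerCocycle_apply]
  change (h : G) • x.root n / x.root n = 1
  rw [hfix h n, div_self']

end CyclotomeCoefficients

namespace ThetaSetting

variable {p : ℕ} [Fact p.Prime] {D : ThetaSetting p}

namespace ThetaKummerInput

variable (T : D.ThetaKummerInput)

/-! ### §1. `ι`-fixed elements of `Π^tp_Ÿ` fix the root system `ιFn(θ_N)·θ_N⁻¹` -/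

/-- The collapsed coefficient compatibility `c(Λ(ιFn) ζ) = c(ζ)` with INJECTIVE coefficients `Λ(Fn) ↪ Δ_Θ` (the genuine
case «`Λ(Fn) = Ẑ(1) ≅ Δ_Θ`», p. 12) says: `Λ(ιFn)` is the identity of `Λ(Fn)`. [cite: MochizukiEtTh2009, §1 p.12] -/
theorem cyclotome_map_eq_self_of_injective (ιFn : T.Fn →* T.Fn) (hinj : Function.Injective T.coeff.hom)
    (hΛ' : ∀ ζ : cyclotome T.Fn, T.coeff.hom (cyclotome.map ιFn ζ) = T.coeff.hom ζ) (ζ : cyclotome T.Fn) :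
    cyclotome.map ιFn ζ = ζ :=
  hinj (hΛ' ζ)

/-- The same from the un-collapsed compatibility `hcoeff` of `ThetaKummerInversionTransport.lean` when the companion
`β` acts by `+1` on `Δ_Θ` (Prop 2.2 (i)). [cite: MochizukiEtTh2009, Prop 2.2 (i) p.37] -/
theorem cyclotome_map_eq_self_of_coeffMap (ιFn : T.Fn →* T.Fn) (hinj : Function.Injective T.coeff.hom)
    (β : D.GtpTheta ≃ₜ* D.GtpTheta) (hA : ∀ a' : D.GtpTheta, a' ∈ D.DeltaTheta → β a' ∈ D.DeltaTheta)
    (hβ : ∀ a' ∈ D.DeltaTheta, β a' = a')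
    (hcoeff : ∀ ζ : cyclotome T.Fn, ContH1Aut.coeffMap D.DeltaTheta β hA (T.coeff.hom ζ) =
      T.coeff.hom (cyclotome.map ιFn ζ)) (ζ : cyclotome T.Fn) :
    cyclotome.map ιFn ζ = ζ :=
  T.cyclotome_map_eq_self_of_injective ιFn hinj
    (fun ζ => (T.coeffMap_hom_eq_iff_of_acts_trivially β hA hβ ιFn ζ).1 (hcoeff ζ)) ζ

/-- **`ι`-fixed elements of `Π^tp_Ÿ` fix `d_N := ιFn(θ_N)·θ_N⁻¹`.** For a pull-back of functions `ιFn` over `ι` (`hιFn`)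
acting trivially on `Λ(Fn)` (`hΛ`), an element `g ∈ Π^tp_Ÿ` with `ι g = g` and a compatible root `θ_N` of `Θ̈`:
`g • (ιFn θ_N · θ_N⁻¹) = ιFn θ_N · θ_N⁻¹` — because the Kummer cocycle value `g • θ_N / θ_N` lies in `Λ(Fn)`.
[cite: MochizukiEtTh2009, Prop 1.4 (ii) p.22] -/
theorem smul_inversionRoot_eq (ι : D.PiTemp ≃ₜ* D.PiTemp) (ιFn : T.Fn →* T.Fn)
    (hιFn : ∀ (g : D.PiTemp) (f : T.Fn), ιFn (g • f) = ι g • ιFn f)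
    (hΛ : ∀ ζ : cyclotome T.Fn, cyclotome.map ιFn ζ = ζ)
    {g : D.PiTemp} (hg : g ∈ D.GtpYdd) (hfix : ι g = g) (N : ℕ+) :
    g • (ιFn (T.thetaRoots.root N) * (T.thetaRoots.root N)⁻¹) =
      ιFn (T.thetaRoots.root N) * (T.thetaRoots.root N)⁻¹ := by
  set θN := T.thetaRoots.root N with hθN
  -- `ιFn` fixes the Kummer cocycle value `g • θN / θN`, a component of an element of `Λ(Fn)`
  have h1 : ιFn (g • θN / θN) = g • θN / θN := by
    have h := congrArg (fun ζ : cyclotome T.Fn => ((ζ : ℕ+ → T.Fn) N))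
      (hΛ (T.thetaRoots.kummerCocycle T.theta_mem ⟨g, hg⟩))
    simpa only [cyclotome.map_apply, RootSystem.kummerCocycle_apply, Subgroup.mk_smul] using h
  -- hence `g • ιFn θN = (g • θN / θN) · ιFn θN`
  have h2 : g • ιFn θN = g • θN / θN * ιFn θN := by
    have h3 : ιFn (g • θN) = g • θN / θN * ιFn θN := by
      rw [← h1, ← map_mul, div_mul_cancel]
    rw [← h3, hιFn, hfix]
  rw [smul_mul', smul_inv', h2, mul_comm (g • θN / θN) (ιFn θN), mul_assoc, div_eq_mul_inv,
    mul_comm (g • θN) θN⁻¹, mul_assoc, mul_inv_cancel, mul_one]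

/-- **The defect of `ι`-invariance of the theta Kummer cocycle IS the Kummer cocycle of `const(−1)`** (general form of
`smul_inversionRoot_eq`, no fixedness assumed): for `g ∈ Π^tp_Ÿ` with `ι g ∈ Π^tp_Ÿ` and every level `N`,
`(g•θ_N/θ_N) · d_N = (ι g • d_N) · (ι g • θ_N/θ_N)` where `d_N := ιFn(θ_N)·θ_N⁻¹` — i.e. additively
`λ_Θ̈(g) − λ_Θ̈(ι g) = κ_{d}(ι g)`. DESIGN CONSEQUENCE for models: on elements acting trivially on `d` (e.g. geometric ones
when `d` is constant) the theta Kummer cocycle must be `ι`-INVARIANT — a «`y`-coordinate» theta class (negated by the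
inversion) is excluded; print's `η̈^Θ` is the `ι`-invariant centre («`z`») class. [cite: MochizukiEtTh2009, Prop 1.4 (ii) p.22] -/
theorem kummerCocycle_mul_inversionRoot_eq (ι : D.PiTemp ≃ₜ* D.PiTemp) (ιFn : T.Fn →* T.Fn)
    (hιFn : ∀ (g : D.PiTemp) (f : T.Fn), ιFn (g • f) = ι g • ιFn f)
    (hΛ : ∀ ζ : cyclotome T.Fn, cyclotome.map ιFn ζ = ζ)
    {g : D.PiTemp} (hg : g ∈ D.GtpYdd) (N : ℕ+) :
    (g • T.thetaRoots.root N / T.thetaRoots.root N) * (ιFn (T.thetaRoots.root N) * (T.thetaRoots.root N)⁻¹) =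
      ι g • (ιFn (T.thetaRoots.root N) * (T.thetaRoots.root N)⁻¹) *
        (ι g • T.thetaRoots.root N / T.thetaRoots.root N) := by
  set θN := T.thetaRoots.root N with hθN
  have h1 : ιFn (g • θN / θN) = g • θN / θN := by
    have h := congrArg (fun ζ : cyclotome T.Fn => ((ζ : ℕ+ → T.Fn) N))
      (hΛ (T.thetaRoots.kummerCocycle T.theta_mem ⟨g, hg⟩))
    simpa only [cyclotome.map_apply, RootSystem.kummerCocycle_apply, Subgroup.mk_smul] using h
  -- `ιFn (g • θN) = (g•θN/θN) · ιFn θN` and `ιFn (g • θN) = ι g • ιFn θN`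
  have h2 : ι g • ιFn θN = g • θN / θN * ιFn θN := by
    rw [← hιFn, ← h1, ← map_mul, div_mul_cancel]
  -- divide by `ι g • θN`
  have h3 : ι g • (ιFn θN * θN⁻¹) * (ι g • θN / θN) = ι g • ιFn θN * θN⁻¹ := by
    rw [smul_mul', smul_inv', div_eq_mul_inv, mul_mul_mul_comm, mul_assoc, mul_inv_cancel_left]
  rw [h3, h2, mul_assoc]

/-- The same WITHOUT `hΛ` (general companion `β`, e.g. the [IUTchII] Cor 3.5 (ii) binders of abc-iut-w4-d004): for any `g`,
`ιFn(g•θ_N/θ_N) · d_N = (ι g • d_N) · (ι g • θ_N/θ_N)`. [cite: MochizukiEtTh2009, Prop 1.4 (ii) p.22] -/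
theorem map_kummerCocycle_mul_inversionRoot_eq (ι : D.PiTemp ≃ₜ* D.PiTemp) (ιFn : T.Fn →* T.Fn)
    (hιFn : ∀ (g : D.PiTemp) (f : T.Fn), ιFn (g • f) = ι g • ιFn f) (g : D.PiTemp) (N : ℕ+) :
    ιFn (g • T.thetaRoots.root N / T.thetaRoots.root N) * (ιFn (T.thetaRoots.root N) * (T.thetaRoots.root N)⁻¹) =
      ι g • (ιFn (T.thetaRoots.root N) * (T.thetaRoots.root N)⁻¹) *
        (ι g • T.thetaRoots.root N / T.thetaRoots.root N) := by
  set θN := T.thetaRoots.root N with hθN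
  have h2 : ι g • ιFn θN = ιFn (g • θN / θN) * ιFn θN := by rw [← hιFn, ← map_mul, div_mul_cancel]
  have h3 : ι g • (ιFn θN * θN⁻¹) * (ι g • θN / θN) = ι g • ιFn θN * θN⁻¹ := by
    rw [smul_mul', smul_inv', div_eq_mul_inv, mul_mul_mul_comm, mul_assoc, mul_inv_cancel_left]
  rw [h3, h2, mul_assoc]

/-! ### §2. Consequence for the Kummer class of `−1` -/

/-- **The Kummer class `κ(−1)` dies on every `ι`-fixed subgroup of `Π^tp_Ÿ`.** Under the function-level package
(`hιFn`, `hΛ`, `hιθ : ιFn Θ̈ = const(−1)·Θ̈`) the family `d_N := ιFn(θ_N)·θ_N⁻¹` is a compatible root system of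
`const(−1)` fixed by every `ι`-fixed `g ∈ Π^tp_Ÿ`; the Kummer class of `const(−1)` does not depend on the root system
(abc-iut-L2-t12 `kummerContClass_eq`), so its restriction to any `H₀ ≤ Π^tp_Ÿ` consisting of `ι`-fixed elements is `1`.
[cite: MochizukiEtTh2009, Prop 1.3 p.21] -/
theorem res_kummerConst_neg_one_eq_one_of_fixed (ι : D.PiTemp ≃ₜ* D.PiTemp) (ιFn : T.Fn →* T.Fn)
    (hιFn : ∀ (g : D.PiTemp) (f : T.Fn), ιFn (g • f) = ι g • ιFn f)
    (hΛ : ∀ ζ : cyclotome T.Fn, cyclotome.map ιFn ζ = ζ)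
    (hιθ : ιFn T.theta = T.const (-1) * T.theta)
    {H₀ : Subgroup D.PiTemp} (hle : H₀ ≤ D.GtpYdd) (hfix : ∀ g ∈ H₀, ι g = g) :
    ContH1.res D.toTheta D.DeltaTheta hle (T.kummerConst (-1)) = 1 := by
  -- the root system `d` of `const(−1)`
  have hd1 : ιFn T.theta * T.theta⁻¹ = T.const (-1) := by rw [hιθ, mul_inv_cancel_right]
  let d : RootSystem (T.const (-1)) := ((T.thetaRoots.map ιFn).mul T.thetaRoots.inv).cast hd1
  have hd : ∀ N, d.root N = ιFn (T.thetaRoots.root N) * (T.thetaRoots.root N)⁻¹ := fun N => rfl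
  rw [kummerConst, T.coeff.kummerContClass_eq D.GtpYdd (T.constRoots (-1)) d (T.const_mem (-1)) _
      (fun _ => T.isOpen_stabilizer _),
    T.coeff.res_kummerContClass hle d (T.const_mem (-1)) (fun _ => T.isOpen_stabilizer _)]
  refine T.coeff.kummerContClass_eq_one_of_forall_smul_eq H₀ d _ _ fun h N => ?_
  rw [hd]
  exact T.smul_inversionRoot_eq ι ιFn hιFn hΛ (hle h.2) (hfix h h.2) N

/-- The same for the ABSTRACT Kummer class of `−1` of a Kummer datum `k` COMPATIBLE with `T` (abc-iut-L2-t12's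
`ConstCompat`: `infl(kumYdd(c)) = κ_T(c)`): `infl(kumYdd(−1))` restricts to `1` on every `ι`-fixed `H₀ ≤ Π^tp_Ÿ`.
[cite: MochizukiEtTh2009, Prop 1.3 p.21] -/
theorem res_inflTheta_kumYdd_neg_one_eq_one_of_constCompat (ι : D.PiTemp ≃ₜ* D.PiTemp) (ιFn : T.Fn →* T.Fn)
    (hιFn : ∀ (g : D.PiTemp) (f : T.Fn), ιFn (g • f) = ι g • ιFn f)
    (hΛ : ∀ ζ : cyclotome T.Fn, cyclotome.map ιFn ζ = ζ)
    (hιθ : ιFn T.theta = T.const (-1) * T.theta)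
    {k : D.KummerData} (hcc : T.ConstCompat k)
    {H₀ : Subgroup D.PiTemp} (hle : H₀ ≤ D.GtpYdd) (hfix : ∀ g ∈ H₀, ι g = g) :
    ContH1.res D.toTheta D.DeltaTheta hle (D.inflTheta D.GtpYdd (k.kumYdd (k.toKddHat (-1)))) = 1 := by
  rw [hcc (-1)]
  exact T.res_kummerConst_neg_one_eq_one_of_fixed ι ιFn hιFn hΛ hιθ hle hfix

/-- **NO-GO SCHEMA.** If the Kummer class `κ_T(−1)` is VISIBLE on some subgroup `H₀ ≤ Π^tp_Ÿ` of `ι`-fixed elements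
(`res ≠ 1`), then NO pull-back of functions `ιFn` over `ι` satisfies the function-level [EtTh] Prop 1.4 (ii) package
(`hιFn ∧ hΛ ∧ hιθ`). [cite: MochizukiEtTh2009, Prop 1.4 (ii) p.22] -/
theorem not_exists_package_of_res_kummerConst_ne_one (ι : D.PiTemp ≃ₜ* D.PiTemp)
    {H₀ : Subgroup D.PiTemp} (hle : H₀ ≤ D.GtpYdd) (hfix : ∀ g ∈ H₀, ι g = g)
    (hne : ContH1.res D.toTheta D.DeltaTheta hle (T.kummerConst (-1)) ≠ 1) :
    ¬ ∃ ιFn : T.Fn →* T.Fn, (∀ (g : D.PiTemp) (f : T.Fn), ιFn (g • f) = ι g • ιFn f) ∧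
      (∀ ζ : cyclotome T.Fn, cyclotome.map ιFn ζ = ζ) ∧ ιFn T.theta = T.const (-1) * T.theta := by
  rintro ⟨ιFn, hιFn, hΛ, hιθ⟩
  exact hne (T.res_kummerConst_neg_one_eq_one_of_fixed ι ιFn hιFn hΛ hιθ hle hfix)

/-- The no-go schema in the `ConstCompat` currency: a Kummer datum `k` whose class of `−1` is visible on an `ι`-fixed
`H₀ ≤ Π^tp_Ÿ` is compatible with NO `T` carrying the function-level package for `ι`.
[cite: MochizukiEtTh2009, Prop 1.3 p.21] -/
theorem not_constCompat_of_package_of_res_ne_one (ι : D.PiTemp ≃ₜ* D.PiTemp) (ιFn : T.Fn →* T.Fn)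
    (hιFn : ∀ (g : D.PiTemp) (f : T.Fn), ιFn (g • f) = ι g • ιFn f)
    (hΛ : ∀ ζ : cyclotome T.Fn, cyclotome.map ιFn ζ = ζ)
    (hιθ : ιFn T.theta = T.const (-1) * T.theta) (k : D.KummerData)
    {H₀ : Subgroup D.PiTemp} (hle : H₀ ≤ D.GtpYdd) (hfix : ∀ g ∈ H₀, ι g = g)
    (hne : ContH1.res D.toTheta D.DeltaTheta hle (D.inflTheta D.GtpYdd (k.kumYdd (k.toKddHat (-1)))) ≠ 1) :
    ¬ T.ConstCompat k := fun hcc =>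
  hne (T.res_inflTheta_kumYdd_neg_one_eq_one_of_constCompat ι ιFn hιFn hΛ hιθ hcc hle hfix)

end ThetaKummerInput

/-! ### §2b. NO-GO for Kummer cores: an `ι`-fixed subgroup of `Π^tp_Ÿ` with OPEN Galois image is fatal -/

variable (D) in
/-- Naturality `res ∘ infl = infl ∘ res` for the inflation `H¹(H^Θ, Δ_Θ) → H¹(H, Δ_Θ)` along `Π^tp_X ↠ (Π^tp_X)^Θ` (cocycle
level: both sides are `g ↦ f(g^Θ)`). [cite: NeukirchSchmidtWingberg2008, I §5] -/
theorem res_inflTheta_eq_inflTheta_res {H₀ : Subgroup D.PiTemp} (hle : H₀ ≤ D.GtpYdd)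
    (x : D.H1Theta (D.GtpYdd.map D.toTheta)) :
    ContH1.res D.toTheta D.DeltaTheta hle (D.inflTheta D.GtpYdd x) =
      D.inflTheta H₀ (ContH1.res (MonoidHom.id D.GtpTheta) D.DeltaTheta (Subgroup.map_mono hle) x) := by
  induction x using QuotientGroup.induction_on with
  | H f => rfl

namespace KummerCore

variable (C : D.KummerCore)

omit C in
/-- `-1 ≠ 1` in `K̈^×` (`K̈ ⊆ ℚ̄_p` has characteristic `0`). [cite: MochizukiEtTh2009, §1 p.17] -/
private theorem neg_one_units_Kdd_ne_one : (-1 : (↥D.Kdd)ˣ) ≠ 1 := by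
  intro h
  have h1 : ((-1 : (↥D.Kdd)ˣ) : D.Kdd) = ((1 : (↥D.Kdd)ˣ) : D.Kdd) := by rw [h]
  rw [Units.val_neg, Units.val_one] at h1
  have h2 : ((-1 : D.Kdd) : PadicAlgCl p) = ((1 : D.Kdd) : PadicAlgCl p) := by rw [h1]
  simp only [IntermediateField.coe_neg, IntermediateField.coe_one] at h2
  exact two_ne_zero (by linear_combination -h2 : (2 : PadicAlgCl p) = 0)

/-- **NO-GO (any Kummer core).** Let `C` be a Kummer core of `D` (genuine p-adic Kummer theory: `Ẑ(1) ≅ Δ_Θ`,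
constants `ℚ̄_p^×` through `augTheta`) and `T` a theta-Kummer input COMPATIBLE with `C`'s Kummer data (`ConstCompat`).
If an inversion `ι` FIXES pointwise a subgroup `H₀ ≤ Π^tp_Ÿ` whose Galois image `augTheta(H₀^Θ)` is the absolute Galois
group `G_L` of a FINITE extension `L/ℚ_p`, then NO pull-back of functions `ιFn` over `ι` satisfies the function-level
[EtTh] Prop 1.4 (ii) package `hιFn ∧ hΛ ∧ hιθ`: otherwise `κ(−1)|_{H₀} = 1` (§2), so by Kummer-faithfulness of
`(ℚ̄_p^×)^{G_L} = L^×` (`⋂_N (L^×)^N = 1`, abc-iut-w5-d171 / abc-iut-L4) `−1 = 1` in `K̈`. In print the inversion of `X`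
reverses the tangential base point at the origin, so it fixes no Galois section on which `−1` is Kummer-visible —
consistent. [cite: MochizukiEtTh2009, Prop 1.3 p.21] -/
theorem not_exists_package_of_constCompat_of_fixed (T : D.ThetaKummerInput) (hcc : T.ConstCompat C.toKummerData)
    (ι : D.PiTemp ≃ₜ* D.PiTemp) {H₀ : Subgroup D.PiTemp} (hle : H₀ ≤ D.GtpYdd) (hfix : ∀ g ∈ H₀, ι g = g)
    (L : IntermediateField ℚ_[p] (PadicAlgCl p)) [FiniteDimensional ℚ_[p] L]
    (hH : (H₀.map D.toTheta).map C.augTheta = L.fixingSubgroup) :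
    ¬ ∃ ιFn : T.Fn →* T.Fn, (∀ (g : D.PiTemp) (f : T.Fn), ιFn (g • f) = ι g • ιFn f) ∧
      (∀ ζ : cyclotome T.Fn, cyclotome.map ιFn ζ = ζ) ∧ ιFn T.theta = T.const (-1) * T.theta := by
  rintro ⟨ιFn, hιFn, hΛ, hιθ⟩
  letI := D.unitsAction C.augTheta
  have h1 := T.res_inflTheta_kumYdd_neg_one_eq_one_of_constCompat ι ιFn hιFn hΛ hιθ hcc hle hfix
  rw [D.res_inflTheta_eq_inflTheta_res hle] at h1
  -- on the theta quotient: the restricted Kummer class of `−1` on `H₀^Θ` is trivial (inflation is injective)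
  have h2 : ContH1.res (MonoidHom.id D.GtpTheta) D.DeltaTheta (Subgroup.map_mono hle)
      (C.coeff.kummerContMap (D.GtpYdd.map D.toTheta) C.isOpen_stabilizer' (C.toInvYdd (-1))) = 1 :=
    D.inflTheta_injective H₀ (h1.trans (map_one _).symm)
  -- `res ∘ κ = κ` on the smaller group, and `κ` is injective there by Kummer-faithfulness of `L^×`
  rw [C.coeff.res_kummerContMap (Subgroup.map_mono hle) C.isOpen_stabilizer' (C.toInvYdd (-1))] at h2
  have hinj := C.coeff.kummerContMap_injective (H := H₀.map D.toTheta) C.isOpen_stabilizer'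
    C.bijective_coeffHom (C.invariants_kummerFaithful _ L hH)
  have h4 := hinj (h2.trans (map_one _).symm)
  have h5 : C.toInvYdd (-1) = 1 := by
    apply Subtype.ext
    have h4' := congrArg (fun u : invariants (A := (PadicAlgCl p)ˣ) (H₀.map D.toTheta) => (u : (PadicAlgCl p)ˣ)) h4
    exact h4'
  exact neg_one_units_Kdd_ne_one (C.toInvYdd_injective (h5.trans (map_one _).symm))

end KummerCore

end ThetaSetting

/-! ### §3. At the χ-twisted root model: the inversion of record fixes `inr G_{ℚ_p} ≤ Π^tp_Ÿ` -/

namespace SettingModel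

open Literature.AnabelianGeometry.SemiGraphs

variable (p : ℕ) [Fact p.Prime]

/-- The complement `inr(G_{ℚ_p})` of `Π^tp_X = Γ ⋊_χ G_{ℚ_p}` lies in `Π^tp_Ÿ = Π^tp_{Y₂}` of the χ-model (its `Γ`-component is
trivial, `G_{K₂} = G_{ℚ_p}`). [cite: MochizukiEtTh2009, §1 p.17] -/
theorem inrRange_le_GtpYdd_modelχ :
    ((SemidirectProduct.inr : GQp p →* PiTpχ p).range : Subgroup (PiTpχ p)) ≤ (ThetaSetting.modelχ p).GtpYdd := by
  rintro x ⟨σ, rfl⟩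
  rw [GtpYdd_modelχ, mem_YNχ_two_iff, SemidirectProduct.left_inr]
  exact one_mem _

/-- abc-iut-L2-d1's inversion datum of record FIXES the complement pointwise: `ι (inr σ) = inr σ`.
[cite: MochizukiEtTh2009, §2 p.36] -/
theorem twistedInversion_fix_inr :
    ∀ g ∈ ((SemidirectProduct.inr : GQp p →* PiTpχ p).range : Subgroup (PiTpχ p)),
      twistedInversionTop (chi p) (isInducing_leftRightχ p) g = g := by
  rintro g ⟨σ, rfl⟩
  rw [twistedInversionTop_apply]
  exact twistedInversion_inr (chi p) σ

/-- **At `modelχ` with the inversion of record, the function-level package kills `κ_T(−1)` on `inr G_{ℚ_p}`**: for every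
`T : ThetaKummerInput (modelχ p)` and every pull-back `ιFn` over `ι = twistedInversionTop (chi p) …` with `hιFn ∧ hΛ ∧ hιθ`,
the Kummer class of `const(−1)` restricts to `1` on the `ι`-fixed subgroup `inr G_{ℚ_p} ≤ Π^tp_Ÿ`.
[cite: MochizukiEtTh2009, Prop 1.4 (ii) p.22] -/
theorem res_inr_kummerConst_neg_one_eq_one_of_package (T : (ThetaSetting.modelχ p).ThetaKummerInput)
    (ιFn : T.Fn →* T.Fn)
    (hιFn : letI := T.instAction; ∀ (g : (ThetaSetting.modelχ p).PiTemp) (f : T.Fn),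
      ιFn (g • f) = (twistedInversionTop (chi p) (isInducing_leftRightχ p) :
        (ThetaSetting.modelχ p).PiTemp ≃ₜ* (ThetaSetting.modelχ p).PiTemp) g • ιFn f)
    (hΛ : ∀ ζ : cyclotome T.Fn, cyclotome.map ιFn ζ = ζ)
    (hιθ : ιFn T.theta = T.const (-1) * T.theta) :
    ContH1.res (ThetaSetting.modelχ p).toTheta (ThetaSetting.modelχ p).DeltaTheta (inrRange_le_GtpYdd_modelχ p)
      (T.kummerConst (-1)) = 1 :=
  T.res_kummerConst_neg_one_eq_one_of_fixed (twistedInversionTop (chi p) (isInducing_leftRightχ p)) ιFn hιFn hΛ hιθ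
    (inrRange_le_GtpYdd_modelχ p) (twistedInversion_fix_inr p)

/-- The same in the `ConstCompat` currency at the model's own Kummer datum (abc-iut-w5-d171's `kummerDataχ`, genuine
p-adic Kummer theory): a `T` with the function-level package for the inversion of record and `ConstCompat (kummerDataχ p)`
forces `infl(log(−1))|_{inr G_{ℚ_p}} = 1` — which `not_exists_package_modelχ_of_constCompat` below refutes by
Kummer-faithfulness of `ℚ_p^×`. [cite: MochizukiEtTh2009, Prop 1.3 p.21] -/
theorem res_inr_inflTheta_kumYdd_neg_one_eq_one_of_package (T : (ThetaSetting.modelχ p).ThetaKummerInput)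
    (ιFn : T.Fn →* T.Fn)
    (hιFn : letI := T.instAction; ∀ (g : (ThetaSetting.modelχ p).PiTemp) (f : T.Fn),
      ιFn (g • f) = (twistedInversionTop (chi p) (isInducing_leftRightχ p) :
        (ThetaSetting.modelχ p).PiTemp ≃ₜ* (ThetaSetting.modelχ p).PiTemp) g • ιFn f)
    (hΛ : ∀ ζ : cyclotome T.Fn, cyclotome.map ιFn ζ = ζ)
    (hιθ : ιFn T.theta = T.const (-1) * T.theta) (hcc : T.ConstCompat (kummerDataχ p)) :
    ContH1.res (ThetaSetting.modelχ p).toTheta (ThetaSetting.modelχ p).DeltaTheta (inrRange_le_GtpYdd_modelχ p)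
      ((ThetaSetting.modelχ p).inflTheta (ThetaSetting.modelχ p).GtpYdd
        ((kummerDataχ p).kumYdd ((kummerDataχ p).toKddHat (-1)))) = 1 :=
  T.res_inflTheta_kumYdd_neg_one_eq_one_of_constCompat (twistedInversionTop (chi p) (isInducing_leftRightχ p)) ιFn
    hιFn hΛ hιθ hcc (inrRange_le_GtpYdd_modelχ p) (twistedInversion_fix_inr p)

/-- The Galois image of `inr G_{ℚ_p} ≤ Π^tp_Ÿ` through `augTheta` of the model's Kummer core is ALL of `G_{ℚ_p} = G_⊥`
(`aug ∘ inr = id`). [cite: MochizukiEtTh2009, §1 p.12] -/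
theorem map_map_inrRange_augTheta_kummerCoreχ :
    (((SemidirectProduct.inr : GQp p →* PiTpχ p).range : Subgroup (PiTpχ p)).map (ThetaSetting.modelχ p).toTheta).map
        (kummerCoreχ p).augTheta = (⊥ : IntermediateField ℚ_[p] (PadicAlgCl p)).fixingSubgroup := by
  rw [IntermediateField.fixingSubgroup_bot, eq_top_iff]
  rintro σ -
  refine ⟨(ThetaSetting.modelχ p).toTheta (SemidirectProduct.inr σ), ⟨SemidirectProduct.inr σ, ⟨σ, rfl⟩, rfl⟩, ?_⟩
  rw [(kummerCoreχ p).augTheta_toTheta]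
  rfl

/-- **NO-GO AT `modelχ` WITH THE INVERSION OF RECORD.** For EVERY theta-Kummer input `T` over the χ-twisted root model that
is compatible with the model's genuine Kummer data `kummerDataχ` (abc-iut-w5-d171; e.g. the genuine-coefficient inputs
of this seat's `SettingModelChiThetaKummerInput.lean`), there is NO pull-back of functions `ιFn` over abc-iut-L2-d1's
`twistedInversionTop (chi p) …` satisfying the function-level [EtTh] Prop 1.4 (ii) package `hιFn ∧ hΛ ∧ hιθ` — the inversion
fixes `inr G_{ℚ_p} ≤ Π^tp_Ÿ`, whose Galois image is all of `G_{ℚ_p}`. CONSEQUENCE (model design, numbers not a side): the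
hypotheses of the END-TO-END theorems `rigidData_exists_monoIso_over_inversion(_tower)_of_thetaKummer` / abc-iut-w4-d004's
`horb_and_hroots_toRecord_inversion_of_thetaKummer` are NOT jointly instantiable at (`modelχ`, inversion of record,
genuine constants); a witness needs an inversion lift whose fixed part of `Π^tp_Ÿ` has non-open Galois image (e.g. a
`Π^tp_X`-conjugate `Ad(w) ∘ ι`). [cite: MochizukiEtTh2009, Prop 1.4 (ii) p.22] -/
theorem not_exists_package_modelχ_of_constCompat (T : (ThetaSetting.modelχ p).ThetaKummerInput)
    (hcc : T.ConstCompat (kummerDataχ p)) :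
    ¬ ∃ ιFn : T.Fn →* T.Fn,
      (letI := T.instAction; ∀ (g : (ThetaSetting.modelχ p).PiTemp) (f : T.Fn),
        ιFn (g • f) = (twistedInversionTop (chi p) (isInducing_leftRightχ p) :
          (ThetaSetting.modelχ p).PiTemp ≃ₜ* (ThetaSetting.modelχ p).PiTemp) g • ιFn f) ∧
      (∀ ζ : cyclotome T.Fn, cyclotome.map ιFn ζ = ζ) ∧ ιFn T.theta = T.const (-1) * T.theta :=
  haveI : FiniteDimensional ℚ_[p] (⊥ : IntermediateField ℚ_[p] (PadicAlgCl p)) := inferInstance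
  (kummerCoreχ p).not_exists_package_of_constCompat_of_fixed T hcc
    (twistedInversionTop (chi p) (isInducing_leftRightχ p)) (inrRange_le_GtpYdd_modelχ p) (twistedInversion_fix_inr p)
    ⊥ (map_map_inrRange_augTheta_kummerCoreχ p)

end SettingModel

end Literature.AnabelianGeometry.EtaleTheta
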